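/-
Copyright (c) 2026 the pub-hodgecm-mathlib formalisation cell (harness21).  Prover seat hodgecm-mathlib-LH4-p06 (g10) on the K2 VALVE (LEAD F0P6-plan (g16) BATCH #303 (a);
hGnb-CHAIN DESK K2Liu-p23 (g4) WORD #2 DEAL B, brick (c-B) of HN2-CENSUS §4), Track B «K2-LIT», #184♮ = hLiu418 = `stmt-HodgeConjecture-24832`; count-neutral helper.
FILE (c-B-1): the GENERIC growth of a `K₀`-flat family of Siegel sections from ENTRY BOUNDS of the point.  THEOREMS ONLY (no `def`, no instance, no notation, no `sorry`).
-/
import Summits.HodgeConjecture.HodgeConjecture.Theorems.K2LiuKindWFiniteSectionSupBoundBad     -- ★ (K2E3-p26): GENERIC `exists_bound_entries_inv_of_isCompact`; brings ★ p864372 §0 `norm_det_le_pow_of_forall_le`, `norm_mul_apply_le`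
import Summits.HodgeConjecture.HodgeConjecture.Theorems.K2LiuSiegelCharacterUnramifiedShift   -- ★ (K2Liu-p10): `norm_localSiegelCharacter` (generic model)
import Summits.HodgeConjecture.HodgeConjecture.Theorems.K2LiuLocalIntertwiningProperty        -- ★ `absDetDelta_pos`
import HarnessLib

/-!
# Crux `HLiu418`, the `hGnb` road, brick (c-B-1): «THE GROWTH OF A `K₀`-FLAT SIEGEL FAMILY FROM THE ENTRIES OF THE POINT» — for an Iwasawa compact `K₀ ≤ H(F_v)` and a
# `K₀`-flat family `f_s` of Siegel sections, `‖f_s(x)‖ ≤ (∏_{w∣v} (M_κ · R_w)^{n·e}) · B` whenever the `w`-components of `x` have entries of norm `≤ R_w`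
# (`M_κ` = an entry bound of `k⁻¹` on `K₀`, `B` = a bound of `‖f_{s₀}‖` on `K₀`, `2 re s + n ≤ 2e`) — MODEL-GENERIC (`UnitaryGroup.localPi E c (n + n) JD v`, any `n`)

Cell `hodgecm-mathlib`, crux item hLiu418 = `stmt-HodgeConjecture-24832` (lane `--supports … --as helper`, count-neutral), route `HCCMUnconditional`; squad K2 ∕ K2Liu (valve hand from
F0∕P3c∕LH4).  THEOREMS ONLY; ★-only imports; states NO law; the `hGnb` chain, FILE C ED.3's `hPgood`∕`hPbad` and #184♮ stay HYPOTHESES of their consumers.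

WHY (HN2-CENSUS §4 (c-B) «modulus growth on the ball», LH4-p06 CENSUS-cB.v1 94f928c1).  The (c) letter of ★ p864748 needs `sup_{|y| ≤ q^k} ‖f_s(φ(w₂)φ(u(y))g)‖ ≤ (q^k·∏_w H_w(g))^{c₁}·
sup_{K₀}‖f_{s₀}‖`.  The long-root Weyl element `w₂` is NOT `w_Δ`, so ★ p864372's Finding 1 (which kills `y` at `(w_Δ)_v·y·h`) does not apply — the `y`-dependence is real and is PAID
through the entries of the point.  The estimate itself is elementary and frame-free: Iwasawa `x = p·k` (`k ∈ K₀`), the section law `f_s(p k) = χ_s(p) f_s(k)` and flatness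
`f_s(k) = f_{s₀}(k)` give `‖f_s(x)‖ = |det_Δ p|_v^{re s + n/2}·‖f_{s₀}(k)‖` (★ `norm_localSiegelCharacter`, unitary `χ_v`); `p = x·k⁻¹` has `w`-entries `≤ R_w·M_κ`, so does its
`Δ`-block `p₁₁ + p₁₂` (ultrametric), whence `‖det_Δ p_w‖ ≤ (M_κ R_w)^n` (★ `norm_det_le_pow_of_forall_le`) and `|det_Δ p|_v = ∏_w ‖det_Δ p_w‖ ≤ P := ∏_w (M_κ R_w)^n ≥ 1`; finally
`P^{re s + n/2} ≤ P^e`.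
* §1 `norm_deltaBlock_apply_le`, `norm_detDelta_le_pow_of_entries`, `absDetDelta_le_prod_pow_of_entries` — the `Δ`-block and `|det_Δ|_v` against entry bounds.
* §2 `entries_mul_le` — entries of `(x·y)_w` against those of `x_w`, `y_w`.
* §3 HEAD `norm_section_le_of_entries` — the growth bound, with `M_κ` and `B` as BINDERS (good places: `K₀ = K_{H,v}`, `M_κ := 1`; any compact `K₀`: ★
  `exists_bound_entries_inv_of_isCompact` gives `M_κ`, compactness + continuity gives `B`).
WHAT IS NOT CLAIMED: the entry bounds of the long-root translate `φ(w₂)φ(u(y))g` (file (c-B-2) `…SiegelSectionLongRootBallGrowth`), any `v`-uniformity bookkeeping, any socket.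
HONEST LABEL.  Count-neutral helper; `HC_CM` is proved only modulo the 7 printed citations (2 remaining named inputs: hLiu418 = `stmt-HodgeConjecture-24832`, h413 =
`stmt-HodgeConjecture-24833`) until rung 0 closes.
## References
* [HarrisKudlaSweet1996] M. Harris, S. Kudla, W. J. Sweet, *Theta dichotomy for unitary groups*, J. AMS 9 (1996): §1 (1.11), (1.15) (Siegel parabolic, `I_n(s, χ)`, the section law).
* [KudlaRallis1994] S. Kudla, S. Rallis, *A regularized Siegel–Weil formula*, Ann. of Math. 140 (1994): §2 (growth of sections along `P·K`).
* [Casselman1980] W. Casselman, *The unramified principal series of p-adic groups I*, Compositio Math. 40 (1980): §3 (Iwasawa decomposition, the height `|det_Δ p(x)|`).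
* [BorelJacquet1979] A. Borel, H. Jacquet, *Automorphic forms and automorphic representations*, PSPM 33.1 (1979): §1.2 (entry bookkeeping on `GL_n` over local fields).
-/

set_option autoImplicit false
set_option linter.dupNamespace false -- the mandated namespace repeats `HodgeConjecture.HodgeConjecture`

noncomputable section

open scoped Matrix Classical NNReal
open NumberField IsDedekindDomain
open Literature.NumberTheory.Automorphic Literature.NumberTheory.Automorphic.UnitaryGroup
open Literature.NumberTheory.GelbartRogawski1991.UnitaryDualPair.LocalSplitting
open Literature.NumberTheory.K2Lit.LocalSiegelDoubled
open Summit.HodgeConjecture.HodgeConjecture.Cruxes.HLiu418.K2LiuKindWFiniteSectionSupBound (norm_det_le_pow_of_forall_le norm_mul_apply_le)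
open Summit.HodgeConjecture.HodgeConjecture.Cruxes.HLiu418.K2LiuKindWFiniteSectionSupBoundBad (exists_bound_entries_inv_of_isCompact)
open Summit.HodgeConjecture.HodgeConjecture.Cruxes.HLiu418.K2LiuSiegelCharacterUnramifiedShift (norm_localSiegelCharacter)
open Summit.HodgeConjecture.HodgeConjecture.Cruxes.HLiu418.K2LiuLocalIntertwiningProperty (absDetDelta_pos)

namespace Summit.HodgeConjecture.HodgeConjecture.Cruxes.HLiu418.K2LiuSiegelSectionGrowthOfEntries

variable (F : Type) [Field F] [NumberField F] (E : Type) [Field E] [NumberField E] [Algebra F E]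
  (c : E ≃ₐ[F] E) (v : HeightOneSpectrum (𝓞 F)) (n : ℕ) {JD : Matrix (Fin (n + n)) (Fin (n + n)) E}

/-! ## §1 The `Δ`-block and `|det_Δ|_v` against entry bounds -/

/-- **entries of the `Δ`-block**: if the `w`-component of `h` has entries of norm `≤ R`, so does its `Δ`-block `h₁₁ + h₁₂` (a sum of two entries; ultrametric).
[cite: BorelJacquet1979, §1.2] [cite: HarrisKudlaSweet1996, §1 (1.11)] -/
theorem norm_deltaBlock_apply_le (w : PlacesOver E v) (h : UnitaryGroup.localPi E c (n + n) JD v) {R : ℝ}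
    (hh : ∀ a b, ‖(((h : UnitaryGroup.LocalGLPi E (n + n) v) w : GL (Fin (n + n)) (w.1.adicCompletion E)) : Matrix (Fin (n + n)) (Fin (n + n)) (w.1.adicCompletion E)) a b‖ ≤ R)
    (i j : Fin n) : ‖deltaBlock F E c v n w h i j‖ ≤ R := by
  unfold deltaBlock
  simp only [Matrix.add_apply, Matrix.toBlocks₁₁, Matrix.toBlocks₁₂, Matrix.of_apply, Matrix.reindex_apply, Matrix.submatrix_apply]
  exact (IsUltrametricDist.norm_add_le_max _ _).trans (max_le (hh _ _) (hh _ _))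

/-- **`‖det_Δ h_w‖ ≤ R^n`** when the `w`-component of `h` has entries of norm `≤ R` (`0 ≤ R`). [cite: BorelJacquet1979, §1.2] [cite: HarrisKudlaSweet1996, §1 (1.15)] -/
theorem norm_detDelta_le_pow_of_entries (w : PlacesOver E v) (h : UnitaryGroup.localPi E c (n + n) JD v) {R : ℝ} (hR : 0 ≤ R)
    (hh : ∀ a b, ‖(((h : UnitaryGroup.LocalGLPi E (n + n) v) w : GL (Fin (n + n)) (w.1.adicCompletion E)) : Matrix (Fin (n + n)) (Fin (n + n)) (w.1.adicCompletion E)) a b‖ ≤ R) :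
    ‖detDelta F E c v n w h‖ ≤ R ^ n := by
  unfold detDelta
  have h1 := norm_det_le_pow_of_forall_le (deltaBlock F E c v n w h) hR (norm_deltaBlock_apply_le F E c v n w h hh)
  rwa [Fintype.card_fin] at h1

/-- **`|det_Δ h|_v ≤ ∏_{w∣v} (R w)^n`** when every `w`-component of `h` has entries of norm `≤ R w` (`0 ≤ R w`). [cite: HarrisKudlaSweet1996, §1 (1.15)] -/
theorem absDetDelta_le_prod_pow_of_entries (h : UnitaryGroup.localPi E c (n + n) JD v) {R : PlacesOver E v → ℝ} (hR : ∀ w, 0 ≤ R w)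
    (hh : ∀ (w : PlacesOver E v) (a b : Fin (n + n)), ‖(((h : UnitaryGroup.LocalGLPi E (n + n) v) w : GL (Fin (n + n)) (w.1.adicCompletion E)) : Matrix (Fin (n + n)) (Fin (n + n)) (w.1.adicCompletion E)) a b‖ ≤ R w) :
    absDetDelta F E c v n h ≤ ∏ w : PlacesOver E v, R w ^ n := by
  unfold absDetDelta
  exact Finset.prod_le_prod (fun w _ => norm_nonneg _) fun w _ => norm_detDelta_le_pow_of_entries F E c v n w h (hR w) (hh w)

/-! ## §2 Entries of a product -/

/-- **entries of `(x·y)_w`**: `≤ R·S` when `x_w` has entries `≤ R` and `y_w` entries `≤ S` (`0 ≤ R, S`; ultrametric sums). [cite: BorelJacquet1979, §1.2] -/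
theorem entries_mul_le (w : PlacesOver E v) (x y : UnitaryGroup.localPi E c (n + n) JD v) {R S : ℝ} (hR : 0 ≤ R) (hS : 0 ≤ S)
    (hx : ∀ a b, ‖(((x : UnitaryGroup.LocalGLPi E (n + n) v) w : GL (Fin (n + n)) (w.1.adicCompletion E)) : Matrix (Fin (n + n)) (Fin (n + n)) (w.1.adicCompletion E)) a b‖ ≤ R)
    (hy : ∀ a b, ‖(((y : UnitaryGroup.LocalGLPi E (n + n) v) w : GL (Fin (n + n)) (w.1.adicCompletion E)) : Matrix (Fin (n + n)) (Fin (n + n)) (w.1.adicCompletion E)) a b‖ ≤ S)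
    (a b : Fin (n + n)) :
    ‖((((x * y : UnitaryGroup.localPi E c (n + n) JD v) : UnitaryGroup.LocalGLPi E (n + n) v) w : GL (Fin (n + n)) (w.1.adicCompletion E)) : Matrix (Fin (n + n)) (Fin (n + n)) (w.1.adicCompletion E)) a b‖ ≤ R * S := by
  rw [Subgroup.coe_mul, Pi.mul_apply, Units.val_mul]
  exact norm_mul_apply_le _ _ hR hS hx hy a b

/-! ## §3 HEAD — the growth of a `K₀`-flat Siegel family from the entries of the point -/

/-- **HEAD — «THE GROWTH OF A `K₀`-FLAT SIEGEL FAMILY FROM THE ENTRIES OF THE POINT».**  Data: a unitary family of characters `χ_v` (`‖χ_w(u)‖ = 1`); a subgroup `K₀ ≤ H(F_v)`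
with the Iwasawa property `H = P_Δ·K₀` (`hIw`) and an entry bound `M_κ ≥ 1` for `k⁻¹`, `k ∈ K₀` (`hMκ`; ★ `exists_bound_entries_inv_of_isCompact` for compact `K₀`); a family
`f : ℂ → H(F_v) → ℂ` of Siegel sections (`hSieg`) FLAT on `K₀` (`hflat`); a base parameter `s₀` with `‖f_{s₀}‖ ≤ B` on `K₀`; a parameter `s` with
`0 ≤ 2 re s + n ≤ 2e` (`e : ℕ`; the `hs hk` shape of ★ `norm_lambdaLoc_weylDelta_mul_le`); a point `x` whose `w`-components have entries of norm `≤ R w`, `1 ≤ R w`.  THEN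
**`‖f s x‖ ≤ (∏_{w∣v} (M_κ · R w)^{n·e}) · B`**.
[cite: KudlaRallis1994, §2] [cite: Casselman1980, §3] [cite: HarrisKudlaSweet1996, §1 (1.15)] [cite: BorelJacquet1979, §1.2] -/
theorem norm_section_le_of_entries [Algebra.IsQuadraticExtension F E] {δ : E} (hcδ : c δ = -δ) (hδ : δ ≠ 0) {d : F} (hd : δ * δ = algebraMap F E d)
    {T₀ : Matrix (Fin n) (Fin n) F} (hT₀ : T₀.IsSymm) (hJD : JD = (gramD F n T₀).map (algebraMap F E))
    (χv : ∀ w : PlacesOver E v, (w.1.adicCompletion E)ˣ →* ℂˣ) (hχu : ∀ (w : PlacesOver E v) (u : (w.1.adicCompletion E)ˣ), ‖((χv w u : ℂˣ) : ℂ)‖ = 1)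
    (K₀ : Subgroup (UnitaryGroup.localPi E c (n + n) JD v))
    (hIw : ∀ g : UnitaryGroup.localPi E c (n + n) JD v, ∃ p, IsSiegelDelta F E c hcδ hδ hd v n hT₀ hJD p ∧ ∃ k ∈ K₀, g = p * k)
    {Mκ : ℝ} (hMκ1 : 1 ≤ Mκ)
    (hMκ : ∀ k ∈ K₀, ∀ (w : PlacesOver E v) (a b : Fin (n + n)),
      ‖(((k⁻¹ : UnitaryGroup.localPi E c (n + n) JD v) : UnitaryGroup.LocalGLPi E (n + n) v) w : GL (Fin (n + n)) (w.1.adicCompletion E)).val a b‖ ≤ Mκ)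
    (f : ℂ → UnitaryGroup.localPi E c (n + n) JD v → ℂ) (hSieg : ∀ s, IsLocalSiegelSection F E c hcδ hδ hd v n hT₀ hJD χv s (f s))
    (hflat : ∀ s s' : ℂ, ∀ k ∈ K₀, f s k = f s' k)
    (s₀ : ℂ) {B : ℝ} (hB : ∀ k ∈ K₀, ‖f s₀ k‖ ≤ B)
    {s : ℂ} (hs : 0 ≤ 2 * s.re + n) {e : ℕ} (he : 2 * s.re + n ≤ 2 * e)
    (x : UnitaryGroup.localPi E c (n + n) JD v) {R : PlacesOver E v → ℝ} (hR : ∀ w, 1 ≤ R w)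
    (hx : ∀ (w : PlacesOver E v) (a b : Fin (n + n)), ‖(((x : UnitaryGroup.LocalGLPi E (n + n) v) w : GL (Fin (n + n)) (w.1.adicCompletion E)) : Matrix (Fin (n + n)) (Fin (n + n)) (w.1.adicCompletion E)) a b‖ ≤ R w) :
    ‖f s x‖ ≤ (∏ w : PlacesOver E v, (Mκ * R w) ^ (n * e)) * B := by
  have hR0 : ∀ w, 0 ≤ R w := fun w => zero_le_one.trans (hR w)
  have hs' : 0 ≤ s.re + (n : ℝ) / 2 := by linarith
  have he' : s.re + (n : ℝ) / 2 ≤ (e : ℝ) := by linarith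
  have hMκ0 : 0 ≤ Mκ := zero_le_one.trans hMκ1
  have hB1 : ∀ w, 1 ≤ Mκ * R w := fun w => one_le_mul_of_one_le_of_one_le hMκ1 (hR w)
  -- Iwasawa decomposition of the point, the section law, flatness
  obtain ⟨p, hp, k, hk, hxe⟩ := hIw x
  have hval : f s x = localSiegelCharacter F E c v n χv s p * f s₀ k := by rw [hxe, hSieg s p hp k, hflat s s₀ k hk]
  have hpos := absDetDelta_pos F E c hcδ hδ hd v n hT₀ hJD hp
  have hnorm : ‖f s x‖ = absDetDelta F E c v n p ^ (s.re + (n : ℝ) / 2) * ‖f s₀ k‖ := by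
    rw [hval, norm_mul, norm_localSiegelCharacter F E c v n χv hχu s p hpos]
    simp only [Complex.add_re, Complex.div_ofNat_re, Complex.natCast_re]
  -- the entries of `p = x·k⁻¹` and the height bound `|det_Δ p|_v ≤ P := ∏_w (M_κ R_w)^n`
  have hpe : p = x * k⁻¹ := eq_mul_inv_of_mul_eq hxe.symm
  have hpent : ∀ (w : PlacesOver E v) (a b : Fin (n + n)),
      ‖(((p : UnitaryGroup.LocalGLPi E (n + n) v) w : GL (Fin (n + n)) (w.1.adicCompletion E)) : Matrix (Fin (n + n)) (Fin (n + n)) (w.1.adicCompletion E)) a b‖ ≤ Mκ * R w := by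
    intro w a b
    rw [hpe, mul_comm Mκ]
    exact entries_mul_le F E c v n w x k⁻¹ (hR0 w) hMκ0 (hx w) (hMκ k hk w) a b
  have hP : absDetDelta F E c v n p ≤ ∏ w : PlacesOver E v, (Mκ * R w) ^ n :=
    absDetDelta_le_prod_pow_of_entries F E c v n p (fun w => mul_nonneg hMκ0 (hR0 w)) hpent
  have hP1 : 1 ≤ ∏ w : PlacesOver E v, (Mκ * R w) ^ n :=
    calc (1 : ℝ) = ∏ _w : PlacesOver E v, (1 : ℝ) := Finset.prod_const_one.symm
      _ ≤ ∏ w : PlacesOver E v, (Mκ * R w) ^ n := Finset.prod_le_prod (fun _ _ => zero_le_one) fun w _ => one_le_pow₀ (hB1 w)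
  -- the exponent bookkeeping `a^{re s + n/2} ≤ P^{re s + n/2} ≤ P^e`
  have hpow : absDetDelta F E c v n p ^ (s.re + (n : ℝ) / 2) ≤ (∏ w : PlacesOver E v, (Mκ * R w) ^ n) ^ (e : ℝ) :=
    (Real.rpow_le_rpow hpos.le hP hs').trans (Real.rpow_le_rpow_of_exponent_le hP1 he')
  have hprod : (∏ w : PlacesOver E v, (Mκ * R w) ^ n) ^ (e : ℝ) = ∏ w : PlacesOver E v, (Mκ * R w) ^ (n * e) := by
    rw [Real.rpow_natCast, ← Finset.prod_pow]
    exact Finset.prod_congr rfl fun w _ => by rw [pow_mul]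
  rw [hnorm]
  calc absDetDelta F E c v n p ^ (s.re + (n : ℝ) / 2) * ‖f s₀ k‖
      ≤ (∏ w : PlacesOver E v, (Mκ * R w) ^ n) ^ (e : ℝ) * B := mul_le_mul hpow (hB k hk) (norm_nonneg _) (Real.rpow_nonneg (zero_le_one.trans hP1) _)
    _ = (∏ w : PlacesOver E v, (Mκ * R w) ^ (n * e)) * B := by rw [hprod]

end Summit.HodgeConjecture.HodgeConjecture.Cruxes.HLiu418.K2LiuSiegelSectionGrowthOfEntries

end
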